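import Literature.Algebra.Homology.OrderedCechSystemFullRing
import Mathlib.Algebra.Homology.ShortComplex.HomologicalComplex
import HarnessLib

/-!
# Refinement of ordered Čech cochains along a CONSTANT index map vanishes in positive degrees
# (The Stacks Project, Tags 01FG, 01FP: refinement through a one-member cover)

Layer `Algebra/Homology` (pure algebra; THEOREMS only: no definition, no instance, no notation, no named fact, no `sorry`).
Cell `hodgecm-mathlib` FLOOR 0, P1 sub-line F-11, packet (iv)∕J3, (G1) «pull-backs on classes», letter **(G1-d)** (F0P1b-plan (g0)
(R56)∕(R60)∕(R64); B-p10 (g15)).  HC_CM is proved only modulo the 7 printed citations until rung 0 closes — nothing here bears on a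
summit statement.

For systems `M : Finset ι ⥤ ModuleCat A`, `M' : Finset ι' ⥤ ModuleCat A` the refinement of ORDERED cochains along a map of index sets
`θ : ι' → ι` with restriction datum `φ : imageFunctor θ ⋙ M ⟶ M'` is ★ core-1 `OrderedCech.refineCochain θ φ` (signed evaluation on
the `θ`-image tuple; = `res ∘ Θ_θ ∘ ext` by ★ `OrderedCech.Full.res_pullbackCochain_ext`, F0P1b-p01 (g0)).  Along a CONSTANT map
`j ↦ i₀` («every `V_j` lies in the one open `U_{i₀}`», i.e. the refinement factors through the one-member cover `{U_{i₀}}`, whose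
Čech complex is concentrated in degree `0`) the refinement VANISHES identically in every degree `n ≥ 1`: the refined tuple
`(i₀, …, i₀)` of length `n + 1 ≥ 2` repeats an index, and the signed evaluation of an ordered cochain on a tuple with a repeated
index is `0` ([StacksProject, Tag 01FG] «`s_{i₀…i_p} = 0` whenever an index repeats»).

* **`refineCochain_const_eq_zero`** ∕ `refineLinear_const_eq_zero` — `refineCochain (fun _ => i₀) φ₀ n = 0` for `1 ≤ n`;
* **`homologyMap_eq_zero_of_refine_const`** — class form: a cochain map `F : sysComplex M ⟶ sysComplex M'` whose degree-`n`
  component IS that refinement (characterised, not constructed) induces `0` on `Ȟⁿ`, `n ≥ 1` (so `i₁^* p₂^* = 0 = i₂^* p₁^*` on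
  positive-degree classes for the axis inclusions and projections of a product cover, the (G1-d) input of F-J3b).

## References
* The Stacks Project, Tag 01FG (Čech complexes; vanishing on tuples with a repeated index), Tag 01FP (refinements). [StacksProject]
* U. Görtz, T. Wedhorn, *Algebraic Geometry II* (2023), Def. 21.64, Def. 21.68 (pp. 179–181). [GortzWedhorn2023]
-/
universe v u

open CategoryTheory

set_option backward.isDefEq.respectTransparency false -- `ModuleCat`-valued functors (as in ★ `OrderedCechSystem`)

noncomputable section

namespace Literature.Algebra.Homology

namespace OrderedCech

variable {ι : Type} [LinearOrder ι] {ι' : Type} [LinearOrder ι'] {A : Type u} [CommRing A]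
  {M : Finset ι ⥤ ModuleCat.{v} A} {M' : Finset ι' ⥤ ModuleCat.{v} A}

/-! ## (G1-d) Refinement along a constant index map vanishes in positive degrees -/

section Const

variable (i₀ : ι) (φ₀ : imageFunctor (fun _ : ι' => i₀) ⋙ M ⟶ M')

/-- **(G1-d) A CONSTANT index map kills `Č^{≥ 1}` on the nose**: `refineCochain (fun _ => i₀) φ₀ n = 0` for `n ≥ 1` — the
refined tuple `(i₀, …, i₀)` of length `n + 1 ≥ 2` repeats an index, so its signed evaluation vanishes («`s_{i₀…i_p} = 0` if an
index repeats»). [cite: StacksProject, Tag 01FG] [cite: StacksProject, Tag 01FP] -/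
theorem refineCochain_const_eq_zero {n : ℤ} (hn : 1 ≤ n) (g : SysCochain M n) :
    refineCochain (fun _ : ι' => i₀) φ₀ n g = 0 := by
  funext σ'
  rw [refineCochain_apply]
  have hc : 2 ≤ σ'.1.card := by have := σ'.2.2; omega
  have hnotinj : ¬ Function.Injective ((fun _ : ι' => i₀) ∘ ⇑(σ'.1.orderEmbOfFin rfl)) := by
    intro hinj
    have h01 : (⟨0, by omega⟩ : Fin σ'.1.card) = ⟨1, by omega⟩ := hinj rfl
    exact absurd (congrArg Fin.val h01) (by norm_num)
  rw [SysCochain.altEvalAt_of_not_injective _ hnotinj, map_zero]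
  rfl

/-- The refinement along a constant index map, as a linear map, is `0` in degrees `n ≥ 1`. [cite: StacksProject, Tag 01FG] -/
theorem refineLinear_const_eq_zero {n : ℤ} (hn : 1 ≤ n) : refineLinear (M := M) (fun _ : ι' => i₀) φ₀ n = 0 :=
  LinearMap.ext fun g => refineCochain_const_eq_zero i₀ φ₀ hn g

/-- **(G1-d), class form**: a cochain map of ordered Čech complexes whose degree-`n` component IS the refinement along a
constant index map (characterised, not constructed) induces `0` on `Ȟⁿ` for every `n ≥ 1` (its degree-`n` component is
the zero map). [cite: StacksProject, Tag 01FP] [cite: StacksProject, Tag 01FG] -/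
theorem homologyMap_eq_zero_of_refine_const (F : sysComplex M ⟶ sysComplex M') {n : ℤ} (hn : 1 ≤ n)
    (hF : ∀ g : SysCochain M n, (F.f n).hom g = refineCochain (fun _ : ι' => i₀) φ₀ n g) :
    HomologicalComplex.homologyMap F n = 0 := by
  have hf : F.f n = 0 := by
    ext g
    change (F.f n).hom g = 0
    rw [hF, refineCochain_const_eq_zero i₀ φ₀ hn]
  have hcyc : HomologicalComplex.cyclesMap F n = 0 := by
    rw [← cancel_mono ((sysComplex M').iCycles n), HomologicalComplex.cyclesMap_i, hf, Limits.comp_zero,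
      Limits.zero_comp]
  rw [← cancel_epi ((sysComplex M).homologyπ n), HomologicalComplex.homologyπ_naturality, hcyc, Limits.zero_comp,
    Limits.comp_zero]

end Const

end OrderedCech

end Literature.Algebra.Homology

end
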